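import Mathlib
import HarnessLib
import Summits.ValiantsHypothesis.ValiantsHypothesis.Theorems.LacunarySymmetroidMatrixDescartesOsculationCensusRankOneCert

/-!
# ValiantsHypothesis / LacunarySymmetroid — crux `MatrixDescartes` (stmt-ValiantsHypothesis-18050, V1),
# line «osculation-law» (`Cruxes/MatrixDescartes/Lines/osculation_law.lean`), rung O3 «extremal-support families from the census»:
# the RANK-ONE LOWER CERTIFICATE — osculation points EXHIBITED by sign changes (the LOWER side of the O3 calibration)

Roster R2664 (b) / R2685 (O3 = val-sym-engine-7); critic val-idea-crit-1 VERDICT #76: «the O3 CONTENT is the LOWER side — exact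
counts ATTAINED by the census extremisers … because that is what prices the LAW's budget from below».  Companion of
`…OsculationCensusRankOneCert` (the upper side: finiteness + `ncard ≤ 2(N_F + N_A)`).

CONTENT.  `OsculationCensus.osc_rankOne_card_ge` (every `s`, every `K`): for a block pencil on `Fin 1 ⊕ Fin s` with `F = det G`,
`A = det G₂₂` and the reduced eliminant `R = W(F)·A² − W(A)·F²`: given `k` pairwise disjoint compact intervals `[lᵢ, uᵢ] ⊂ (0,∞)` on
each of which `F·A < 0` (so the branch `b = −F/A` of the spectral curve lies in the open quadrant there) and at whose end-points
`R` takes values of opposite sign (`R(lᵢ)·R(uᵢ) ≤ 0`), the osculation set (the line's `osculationSet d S`, UNFOLDED verbatim) has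
AT LEAST `k` points (given that it is finite, e.g. by `osc_rankOne_finite_card_le`).  Proof: the intermediate value theorem gives a
zero `tᵢ ∈ [lᵢ, uᵢ]` of `R`; the point `(tᵢ, −F(tᵢ)/A(tᵢ))` lies on the curve, in the quadrant, and the tree identity
`OsculationRankOne.hess_identity` (`A²·H = F·R` on the curve) makes the bordered log-Hessian vanish there; the `k` points have
distinct abscissae.  Instances (exact dyadic end-points, `norm_num`/`linarith` sign certificates) are filed separately.

HONEST FRAMING.  Calibration tooling for a line stub (`m = 2` is covered by `rungTwo`); the LAW `stub_osculationLaw`, the crux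
`MatrixDescartes`, Conjecture B and `VP ≠ VNP` are OPEN / NOT proved; no summit statement is proved by this file.  No definitions,
no named facts; Mathlib + tree files.
-/

-- `Summit.ValiantsHypothesis.ValiantsHypothesis.…` is the tree's mandated single-conjunct layout (Sub = Summit).
set_option linter.dupNamespace false

noncomputable section

namespace Summit.ValiantsHypothesis.ValiantsHypothesis.Theorems.LacunarySymmetroidMatrixDescartes

open Polynomial Matrix Finset
open scoped BigOperators

namespace OsculationCensus

/-- A real polynomial whose values at `l ≤ u` have product `≤ 0` vanishes somewhere on `[l, u]`. [folklore: intermediate value theorem] -/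
theorem exists_root_of_mul_nonpos (R : ℝ[X]) {l u : ℝ} (hlu : l ≤ u) (h : R.eval l * R.eval u ≤ 0) :
    ∃ t, l ≤ t ∧ t ≤ u ∧ R.eval t = 0 := by
  have hc : ContinuousOn (fun x => R.eval x) (Set.Icc l u) := R.continuous.continuousOn
  by_cases h0 : R.eval l = 0
  · exact ⟨l, le_rfl, hlu, h0⟩
  rcases lt_or_gt_of_ne h0 with h1 | h1
  · have h2 : 0 ≤ R.eval u := by
      by_contra h2
      have h2' : R.eval u < 0 := lt_of_not_ge h2
      nlinarith [mul_pos_of_neg_of_neg h1 h2']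
    obtain ⟨t, ht, hRt⟩ := intermediate_value_Icc hlu hc ⟨h1.le, h2⟩
    exact ⟨t, ht.1, ht.2, hRt⟩
  · have h2 : R.eval u ≤ 0 := by
      by_contra h2
      have h2' : 0 < R.eval u := lt_of_not_ge h2
      nlinarith [mul_pos h1 h2']
    obtain ⟨t, ht, hRt⟩ := intermediate_value_Icc' hlu hc ⟨h2, h1.le⟩
    exact ⟨t, ht.1, ht.2, hRt⟩

/-- **Rank-one LOWER certificate.**  A list `W` of pairwise separated sign-change windows `(l, u)` of the reduced eliminant
`R = W(F)·A² − W(A)·F²` (`R(l)·R(u) ≤ 0`), on each of which the branch `b = −F/A` is in the open quadrant (`F·A < 0` on `[l, u]`,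
`0 < l ≤ u`), gives `W.length` distinct osculation points (the line's `osculationSet d S`, unfolded verbatim; assumed finite). [folklore] -/
theorem osc_rankOne_card_ge {s K : ℕ} (d : Fin K → ℕ) (S : Fin K → Matrix (Fin 1 ⊕ Fin s) (Fin 1 ⊕ Fin s) ℝ)
    (F A : ℝ[X]) (hF : (∑ l, (X : ℝ[X]) ^ d l • (S l).map Polynomial.C).det = F)
    (hA : (∑ l, (X : ℝ[X]) ^ d l • ((S l).toBlocks₂₂).map Polynomial.C).det = A)
    (hfin :
    {p : Fin 2 → ℝ | 0 < p 0 ∧ 0 < p 1 ∧ MvPolynomial.eval p (∑ l, (MvPolynomial.X (0 : Fin 2) : MvPolynomial (Fin 2) ℝ) ^ d l •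
              (S l).map (MvPolynomial.C : ℝ →+* MvPolynomial (Fin 2) ℝ)
            + (MvPolynomial.X (1 : Fin 2) : MvPolynomial (Fin 2) ℝ) •
              (Matrix.fromBlocks 1 0 0 0 : Matrix (Fin 1 ⊕ Fin s) (Fin 1 ⊕ Fin s) ℝ).map
                (MvPolynomial.C : ℝ →+* MvPolynomial (Fin 2) ℝ)).det = 0 ∧
      MvPolynomial.eval p
        (MvPolynomial.X 0 * MvPolynomial.pderiv 0 (MvPolynomial.X 0 * MvPolynomial.pderiv 0 (∑ l, (MvPolynomial.X (0 : Fin 2) : MvPolynomial (Fin 2) ℝ) ^ d l •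
              (S l).map (MvPolynomial.C : ℝ →+* MvPolynomial (Fin 2) ℝ)
            + (MvPolynomial.X (1 : Fin 2) : MvPolynomial (Fin 2) ℝ) •
              (Matrix.fromBlocks 1 0 0 0 : Matrix (Fin 1 ⊕ Fin s) (Fin 1 ⊕ Fin s) ℝ).map
                (MvPolynomial.C : ℝ →+* MvPolynomial (Fin 2) ℝ)).det)
            * (MvPolynomial.X 1 * MvPolynomial.pderiv 1 (∑ l, (MvPolynomial.X (0 : Fin 2) : MvPolynomial (Fin 2) ℝ) ^ d l •
              (S l).map (MvPolynomial.C : ℝ →+* MvPolynomial (Fin 2) ℝ)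
            + (MvPolynomial.X (1 : Fin 2) : MvPolynomial (Fin 2) ℝ) •
              (Matrix.fromBlocks 1 0 0 0 : Matrix (Fin 1 ⊕ Fin s) (Fin 1 ⊕ Fin s) ℝ).map
                (MvPolynomial.C : ℝ →+* MvPolynomial (Fin 2) ℝ)).det) ^ 2
          - 2 * (MvPolynomial.X 0 * MvPolynomial.pderiv 0 (MvPolynomial.X 1 * MvPolynomial.pderiv 1 (∑ l, (MvPolynomial.X (0 : Fin 2) : MvPolynomial (Fin 2) ℝ) ^ d l •
              (S l).map (MvPolynomial.C : ℝ →+* MvPolynomial (Fin 2) ℝ)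
            + (MvPolynomial.X (1 : Fin 2) : MvPolynomial (Fin 2) ℝ) •
              (Matrix.fromBlocks 1 0 0 0 : Matrix (Fin 1 ⊕ Fin s) (Fin 1 ⊕ Fin s) ℝ).map
                (MvPolynomial.C : ℝ →+* MvPolynomial (Fin 2) ℝ)).det))
            * (MvPolynomial.X 0 * MvPolynomial.pderiv 0 (∑ l, (MvPolynomial.X (0 : Fin 2) : MvPolynomial (Fin 2) ℝ) ^ d l •
              (S l).map (MvPolynomial.C : ℝ →+* MvPolynomial (Fin 2) ℝ)
            + (MvPolynomial.X (1 : Fin 2) : MvPolynomial (Fin 2) ℝ) •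
              (Matrix.fromBlocks 1 0 0 0 : Matrix (Fin 1 ⊕ Fin s) (Fin 1 ⊕ Fin s) ℝ).map
                (MvPolynomial.C : ℝ →+* MvPolynomial (Fin 2) ℝ)).det) * (MvPolynomial.X 1 * MvPolynomial.pderiv 1 (∑ l, (MvPolynomial.X (0 : Fin 2) : MvPolynomial (Fin 2) ℝ) ^ d l •
              (S l).map (MvPolynomial.C : ℝ →+* MvPolynomial (Fin 2) ℝ)
            + (MvPolynomial.X (1 : Fin 2) : MvPolynomial (Fin 2) ℝ) •
              (Matrix.fromBlocks 1 0 0 0 : Matrix (Fin 1 ⊕ Fin s) (Fin 1 ⊕ Fin s) ℝ).map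
                (MvPolynomial.C : ℝ →+* MvPolynomial (Fin 2) ℝ)).det)
          + MvPolynomial.X 1 * MvPolynomial.pderiv 1 (MvPolynomial.X 1 * MvPolynomial.pderiv 1 (∑ l, (MvPolynomial.X (0 : Fin 2) : MvPolynomial (Fin 2) ℝ) ^ d l •
              (S l).map (MvPolynomial.C : ℝ →+* MvPolynomial (Fin 2) ℝ)
            + (MvPolynomial.X (1 : Fin 2) : MvPolynomial (Fin 2) ℝ) •
              (Matrix.fromBlocks 1 0 0 0 : Matrix (Fin 1 ⊕ Fin s) (Fin 1 ⊕ Fin s) ℝ).map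
                (MvPolynomial.C : ℝ →+* MvPolynomial (Fin 2) ℝ)).det)
            * (MvPolynomial.X 0 * MvPolynomial.pderiv 0 (∑ l, (MvPolynomial.X (0 : Fin 2) : MvPolynomial (Fin 2) ℝ) ^ d l •
              (S l).map (MvPolynomial.C : ℝ →+* MvPolynomial (Fin 2) ℝ)
            + (MvPolynomial.X (1 : Fin 2) : MvPolynomial (Fin 2) ℝ) •
              (Matrix.fromBlocks 1 0 0 0 : Matrix (Fin 1 ⊕ Fin s) (Fin 1 ⊕ Fin s) ℝ).map
                (MvPolynomial.C : ℝ →+* MvPolynomial (Fin 2) ℝ)).det) ^ 2) = 0}.Finite)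
    (W : List (ℝ × ℝ)) (hsep : W.Pairwise (fun a b => a.2 < b.1))
    (hW : ∀ w ∈ W, 0 < w.1 ∧ w.1 ≤ w.2 ∧ (∀ x, w.1 ≤ x → x ≤ w.2 → F.eval x * A.eval x < 0) ∧
      (((F * (X * derivative (X * derivative F)) - (X * derivative F) ^ 2) * A ^ 2
          - (A * (X * derivative (X * derivative A)) - (X * derivative A) ^ 2) * F ^ 2)).eval w.1 *
      (((F * (X * derivative (X * derivative F)) - (X * derivative F) ^ 2) * A ^ 2
          - (A * (X * derivative (X * derivative A)) - (X * derivative A) ^ 2) * F ^ 2)).eval w.2 ≤ 0) :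
    W.length ≤
    {p : Fin 2 → ℝ | 0 < p 0 ∧ 0 < p 1 ∧ MvPolynomial.eval p (∑ l, (MvPolynomial.X (0 : Fin 2) : MvPolynomial (Fin 2) ℝ) ^ d l •
              (S l).map (MvPolynomial.C : ℝ →+* MvPolynomial (Fin 2) ℝ)
            + (MvPolynomial.X (1 : Fin 2) : MvPolynomial (Fin 2) ℝ) •
              (Matrix.fromBlocks 1 0 0 0 : Matrix (Fin 1 ⊕ Fin s) (Fin 1 ⊕ Fin s) ℝ).map
                (MvPolynomial.C : ℝ →+* MvPolynomial (Fin 2) ℝ)).det = 0 ∧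
      MvPolynomial.eval p
        (MvPolynomial.X 0 * MvPolynomial.pderiv 0 (MvPolynomial.X 0 * MvPolynomial.pderiv 0 (∑ l, (MvPolynomial.X (0 : Fin 2) : MvPolynomial (Fin 2) ℝ) ^ d l •
              (S l).map (MvPolynomial.C : ℝ →+* MvPolynomial (Fin 2) ℝ)
            + (MvPolynomial.X (1 : Fin 2) : MvPolynomial (Fin 2) ℝ) •
              (Matrix.fromBlocks 1 0 0 0 : Matrix (Fin 1 ⊕ Fin s) (Fin 1 ⊕ Fin s) ℝ).map
                (MvPolynomial.C : ℝ →+* MvPolynomial (Fin 2) ℝ)).det)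
            * (MvPolynomial.X 1 * MvPolynomial.pderiv 1 (∑ l, (MvPolynomial.X (0 : Fin 2) : MvPolynomial (Fin 2) ℝ) ^ d l •
              (S l).map (MvPolynomial.C : ℝ →+* MvPolynomial (Fin 2) ℝ)
            + (MvPolynomial.X (1 : Fin 2) : MvPolynomial (Fin 2) ℝ) •
              (Matrix.fromBlocks 1 0 0 0 : Matrix (Fin 1 ⊕ Fin s) (Fin 1 ⊕ Fin s) ℝ).map
                (MvPolynomial.C : ℝ →+* MvPolynomial (Fin 2) ℝ)).det) ^ 2
          - 2 * (MvPolynomial.X 0 * MvPolynomial.pderiv 0 (MvPolynomial.X 1 * MvPolynomial.pderiv 1 (∑ l, (MvPolynomial.X (0 : Fin 2) : MvPolynomial (Fin 2) ℝ) ^ d l •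
              (S l).map (MvPolynomial.C : ℝ →+* MvPolynomial (Fin 2) ℝ)
            + (MvPolynomial.X (1 : Fin 2) : MvPolynomial (Fin 2) ℝ) •
              (Matrix.fromBlocks 1 0 0 0 : Matrix (Fin 1 ⊕ Fin s) (Fin 1 ⊕ Fin s) ℝ).map
                (MvPolynomial.C : ℝ →+* MvPolynomial (Fin 2) ℝ)).det))
            * (MvPolynomial.X 0 * MvPolynomial.pderiv 0 (∑ l, (MvPolynomial.X (0 : Fin 2) : MvPolynomial (Fin 2) ℝ) ^ d l •
              (S l).map (MvPolynomial.C : ℝ →+* MvPolynomial (Fin 2) ℝ)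
            + (MvPolynomial.X (1 : Fin 2) : MvPolynomial (Fin 2) ℝ) •
              (Matrix.fromBlocks 1 0 0 0 : Matrix (Fin 1 ⊕ Fin s) (Fin 1 ⊕ Fin s) ℝ).map
                (MvPolynomial.C : ℝ →+* MvPolynomial (Fin 2) ℝ)).det) * (MvPolynomial.X 1 * MvPolynomial.pderiv 1 (∑ l, (MvPolynomial.X (0 : Fin 2) : MvPolynomial (Fin 2) ℝ) ^ d l •
              (S l).map (MvPolynomial.C : ℝ →+* MvPolynomial (Fin 2) ℝ)
            + (MvPolynomial.X (1 : Fin 2) : MvPolynomial (Fin 2) ℝ) •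
              (Matrix.fromBlocks 1 0 0 0 : Matrix (Fin 1 ⊕ Fin s) (Fin 1 ⊕ Fin s) ℝ).map
                (MvPolynomial.C : ℝ →+* MvPolynomial (Fin 2) ℝ)).det)
          + MvPolynomial.X 1 * MvPolynomial.pderiv 1 (MvPolynomial.X 1 * MvPolynomial.pderiv 1 (∑ l, (MvPolynomial.X (0 : Fin 2) : MvPolynomial (Fin 2) ℝ) ^ d l •
              (S l).map (MvPolynomial.C : ℝ →+* MvPolynomial (Fin 2) ℝ)
            + (MvPolynomial.X (1 : Fin 2) : MvPolynomial (Fin 2) ℝ) •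
              (Matrix.fromBlocks 1 0 0 0 : Matrix (Fin 1 ⊕ Fin s) (Fin 1 ⊕ Fin s) ℝ).map
                (MvPolynomial.C : ℝ →+* MvPolynomial (Fin 2) ℝ)).det)
            * (MvPolynomial.X 0 * MvPolynomial.pderiv 0 (∑ l, (MvPolynomial.X (0 : Fin 2) : MvPolynomial (Fin 2) ℝ) ^ d l •
              (S l).map (MvPolynomial.C : ℝ →+* MvPolynomial (Fin 2) ℝ)
            + (MvPolynomial.X (1 : Fin 2) : MvPolynomial (Fin 2) ℝ) •
              (Matrix.fromBlocks 1 0 0 0 : Matrix (Fin 1 ⊕ Fin s) (Fin 1 ⊕ Fin s) ℝ).map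
                (MvPolynomial.C : ℝ →+* MvPolynomial (Fin 2) ℝ)).det) ^ 2) = 0}.ncard := by
  classical
  have hΦ := OsculationRankOne.insertionPoly_eq d S
  rw [hF, hA] at hΦ
  rw [hΦ] at hfin ⊢
  set Φ : MvPolynomial (Fin 2) ℝ := Polynomial.aeval (MvPolynomial.X 0 : MvPolynomial (Fin 2) ℝ) F
      + MvPolynomial.X 1 * Polynomial.aeval (MvPolynomial.X 0 : MvPolynomial (Fin 2) ℝ) A with hΦdef
  set R : ℝ[X] := ((F * (X * derivative (X * derivative F)) - (X * derivative F) ^ 2) * A ^ 2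
          - (A * (X * derivative (X * derivative A)) - (X * derivative A) ^ 2) * F ^ 2) with hRdef
  set osc := {p : Fin 2 → ℝ | 0 < p 0 ∧ 0 < p 1 ∧ MvPolynomial.eval p Φ = 0 ∧
      MvPolynomial.eval p
        (MvPolynomial.X 0 * MvPolynomial.pderiv 0 (MvPolynomial.X 0 * MvPolynomial.pderiv 0 Φ)
            * (MvPolynomial.X 1 * MvPolynomial.pderiv 1 Φ) ^ 2
          - 2 * (MvPolynomial.X 0 * MvPolynomial.pderiv 0 (MvPolynomial.X 1 * MvPolynomial.pderiv 1 Φ))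
            * (MvPolynomial.X 0 * MvPolynomial.pderiv 0 Φ) * (MvPolynomial.X 1 * MvPolynomial.pderiv 1 Φ)
          + MvPolynomial.X 1 * MvPolynomial.pderiv 1 (MvPolynomial.X 1 * MvPolynomial.pderiv 1 Φ)
            * (MvPolynomial.X 0 * MvPolynomial.pderiv 0 Φ) ^ 2) = 0} with hosc
  have mem_osc : ∀ p : Fin 2 → ℝ, p ∈ osc ↔ 0 < p 0 ∧ 0 < p 1 ∧ F.eval (p 0) + p 1 * A.eval (p 0) = 0 ∧
      p 0 * ((derivative F).eval (p 0) + p 1 * (derivative A).eval (p 0)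
              + p 0 * ((derivative (derivative F)).eval (p 0)
                  + p 1 * (derivative (derivative A)).eval (p 0)))
          * (p 1 * A.eval (p 0)) ^ 2
        - 2 * (p 0 * (p 1 * (derivative A).eval (p 0)))
          * (p 0 * ((derivative F).eval (p 0) + p 1 * (derivative A).eval (p 0))) * (p 1 * A.eval (p 0))
        + p 1 * A.eval (p 0) * (p 0 * ((derivative F).eval (p 0) + p 1 * (derivative A).eval (p 0))) ^ 2
          = 0 := by
    intro p
    rw [hosc, Set.mem_setOf_eq, OsculationRankOne.eval_logHessian_Phi F A Φ hΦdef p, hΦdef, OsculationRankOne.eval_Phi]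
  -- index the windows
  set k := W.length with hk
  set l : Fin k → ℝ := fun i => (W.get i).1 with hl
  set u : Fin k → ℝ := fun i => (W.get i).2 with hu
  have hWi : ∀ i : Fin k, 0 < l i ∧ l i ≤ u i ∧ (∀ x, l i ≤ x → x ≤ u i → F.eval x * A.eval x < 0) ∧
      R.eval (l i) * R.eval (u i) ≤ 0 := fun i => by
    simpa [hl, hu, hRdef] using hW (W.get i) (List.get_mem W i)
  have hsep' : ∀ i j : Fin k, i < j → u i < l j := by
    intro i j hij
    have := List.pairwise_iff_get.1 hsep i j hij
    simpa [hl, hu] using this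
  -- one zero of `R` per window
  have hroot : ∀ i, ∃ t, l i ≤ t ∧ t ≤ u i ∧ R.eval t = 0 := fun i =>
    exists_root_of_mul_nonpos R (hWi i).2.1 (hWi i).2.2.2
  choose t ht using hroot
  -- the exhibited points
  set pt : Fin k → (Fin 2 → ℝ) := fun i => ![t i, -F.eval (t i) / A.eval (t i)] with hpt
  have hmem : ∀ i, pt i ∈ osc := by
    intro i
    obtain ⟨htl, htu, hRt⟩ := ht i
    have hs := (hWi i).2.2.1 (t i) htl htu
    have hA0 : A.eval (t i) ≠ 0 := fun h => by rw [h, mul_zero] at hs; exact lt_irrefl _ hs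
    have ht0 : 0 < t i := lt_of_lt_of_le (hWi i).1 htl
    have hb : 0 < -F.eval (t i) / A.eval (t i) := by
      have hA2 : 0 < A.eval (t i) ^ 2 := by positivity
      have : -F.eval (t i) / A.eval (t i) = -(F.eval (t i) * A.eval (t i)) / A.eval (t i) ^ 2 := by
        field_simp
      rw [this]
      exact div_pos (by linarith) hA2
    have hcurve : F.eval (t i) + (-F.eval (t i) / A.eval (t i)) * A.eval (t i) = 0 := by
      field_simp
      ring
    refine (mem_osc (pt i)).2 ⟨?_, ?_, ?_, ?_⟩
    · simpa [hpt] using ht0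
    · simpa [hpt] using hb
    · simpa [hpt] using hcurve
    · have key := OsculationRankOne.hess_identity F A (t i) (-F.eval (t i) / A.eval (t i)) hcurve
      rw [← hRdef, hRt, mul_zero] at key
      have hA2 : A.eval (t i) ^ 2 ≠ 0 := pow_ne_zero 2 hA0
      have h0 := (mul_eq_zero.1 key).resolve_left hA2
      simpa [hpt] using h0
  -- distinct abscissae
  have hinj : Function.Injective pt := by
    intro i j hij
    have h0 : t i = t j := by
      have := congr_fun hij 0
      simpa [hpt] using this
    by_contra hne
    rcases lt_or_gt_of_ne hne with h | h
    · have := hsep' i j h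
      linarith [(ht i).2.1, (ht j).1]
    · have := hsep' j i h
      linarith [(ht j).2.1, (ht i).1]
  -- count
  have hsub : ↑(Finset.univ.image pt) ⊆ osc := by
    intro p hp
    rw [Finset.mem_coe, Finset.mem_image] at hp
    obtain ⟨i, -, rfl⟩ := hp
    exact hmem i
  calc k = (Finset.univ.image pt).card := by rw [Finset.card_image_of_injective _ hinj, Finset.card_univ, Fintype.card_fin]
    _ = (↑(Finset.univ.image pt) : Set (Fin 2 → ℝ)).ncard := (Set.ncard_coe_finset _).symm
    _ ≤ osc.ncard := Set.ncard_le_ncard hsub hfin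

end OsculationCensus

end Summit.ValiantsHypothesis.ValiantsHypothesis.Theorems.LacunarySymmetroidMatrixDescartes
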